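import Literature.NumberTheory.LFunctions.SemimultiplicativeMoebius
import Literature.NumberTheory.LFunctions.SemimultiplicativeMoebiusZones
import HarnessLib

/-!
# Konieczny 2020, §3: structure of `q`-semimultiplicative sequences (chain identity, independence)

Topic `Literature/NumberTheory/LFunctions`. Everything in this file is PROVED. For a unimodular
`q`-semimultiplicative `f` with gap `≤ r` (`Literature.NumberTheory.LFunctions.IsSemimultiplicative`,
Konieczny 2020 Definition 3.1) we prove the elementary closure properties of §3 that the proof of
Theorem 1 uses, and the "local data determine global data" identity behind Lemmas 3.2 (2) / 3.5:

* `gap_mono` (`𝒮ℳ_r ⊆ 𝒮ℳ_{r'}` for `r ≤ r'`, "as the notation suggests", §3), `dilate`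
  (Lemma 3.4 (1): dilation by `q^K`), `isQuasimult` (`𝒮ℳ_r ⊆ 𝒬ℳ_r`), `mul`/`conj'` (Lemma 3.4 (1):
  products, conjugates);
* `chain_identity` — for `m < q^{Br}` (`B ≥ 1` consecutive blocks of `r` digits, values
  `x_b = m / q^{br} % q^r`, and a phantom zero block on top):
  `f(m) = f(x_0) ∏_{b<B} f((m / q^{br} % q^{2r}) q^{br}) · conj ∏_{b<B} f(x_b q^{br})`,
  i.e. `f` is the product of its values on adjacent PAIRS of blocks divided by its values on single
  blocks — the consecutive-blocks case of Lemma 3.5, proved directly from Definition 3.1 by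
  peeling the bottom block (`f(n+m+k) f(m) = f(n+m) f(m+k)`);
* `avg_prod_blocks` — digit blocks of a uniform `m < q^L` are independent: the average over
  `m < q^L` of a product of functions of disjoint digit blocks is the product of the block averages.

These feed Proposition 6.3 (`SemimultiplicativeMoebiusLocal.lean`).
-/

noncomputable section

open Finset
open scoped ComplexConjugate

namespace Literature.NumberTheory.LFunctions

namespace Konieczny

/-! ## Closure properties (§3, Lemma 3.4) -/

/-- For unimodular `z`: `z * conj z = 1`. [folklore] -/
theorem mul_conj_eq_one_of_norm {z : ℂ} (hz : ‖z‖ = 1) : z * conj z = 1 := by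
  rw [Complex.mul_conj, Complex.normSq_eq_norm_sq, hz]; simp

/-- `𝒮ℳ_r ⊆ 𝒮ℳ_{r+1}` for unimodular sequences (Konieczny 2020, §3, "as the notation
suggests, `𝒮ℳ_r(G) ⊆ 𝒮ℳ_{r+1}(G)`"). [cite: Konieczny2020, Section 3] -/
theorem gap_mono_succ {q r : ℕ} (hq : 2 ≤ q) {f : ℕ → ℂ} (hf : IsSemimultiplicative q r f)
    (hf1 : ∀ n, ‖f n‖ = 1) : IsSemimultiplicative q (r + 1) f := by
  refine ⟨hf.1, fun l n m k hk hm hmr hn => ?_⟩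
  have hqpos : 0 < q := by omega
  -- split `m = d + m'`, `d` the digit block at position `l`, `q^{l+1} ∣ m'`
  set d := m % q ^ (l + 1) with hd
  set m' := m - d with hm'
  have hmd : m = m' + d := by rw [hm', Nat.sub_add_cancel (Nat.mod_le _ _)]
  have hm'dvd : q ^ (l + 1) ∣ m' := by rw [hm', hd]; exact Nat.dvd_sub_mod m
  have hdl : q ^ l ∣ d := by
    rw [hd]; exact (Nat.dvd_mod_iff (pow_dvd_pow q (Nat.le_succ l))).2 hm
  have hdlt : d < q ^ (l + 1) := by rw [hd]; exact Nat.mod_lt _ (pow_pos hqpos _)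
  have hm'lt : m' < q ^ (l + 1 + r) := by
    have : m' ≤ m := Nat.sub_le _ _
    rw [show l + 1 + r = l + (r + 1) by ring]; omega
  have hn' : q ^ (l + 1 + r) ∣ n := by rwa [show l + 1 + r = l + (r + 1) by ring]
  -- `k + d < q^{l+1}`
  have hkd : k + d < q ^ (l + 1) := by
    obtain ⟨d', hd'⟩ := hdl
    rw [hd'] at hdlt ⊢
    have h1 : d' < q := by
      rw [pow_succ] at hdlt
      exact lt_of_mul_lt_mul_left hdlt (Nat.zero_le _)
    calc k + q ^ l * d' < q ^ l + q ^ l * d' := by omega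
      _ = q ^ l * (d' + 1) := by ring
      _ ≤ q ^ l * q := Nat.mul_le_mul_left _ h1
      _ = q ^ (l + 1) := by rw [pow_succ]
  have h1 := hf.2 (l + 1) n m' (k + d) hkd hm'dvd hm'lt hn'
  have h2 := hf.2 (l + 1) n m' d (lt_of_le_of_lt (Nat.le_add_left d k) hkd) hm'dvd hm'lt hn'
  -- `h1 : f(n+m+k) f(m') = f(n+m') f(m+k)`, `h2 : f(n+m) f(m') = f(n+m') f(m)`
  rw [show n + m' + (k + d) = n + m + k by rw [hmd]; ring,
    show m' + (k + d) = m + k by rw [hmd]; ring] at h1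
  rw [show n + m' + d = n + m by rw [hmd]; ring, show m' + d = m by rw [hmd]] at h2
  have hu : f m' * conj (f m') = 1 := mul_conj_eq_one_of_norm (hf1 m')
  linear_combination (conj (f m') * f m) * h1 - (conj (f m') * f (m + k)) * h2 -
    (f (n + m + k) * f m - f (n + m) * f (m + k)) * hu

/-- `𝒮ℳ_r ⊆ 𝒮ℳ_{r'}` for `r ≤ r'` (unimodular sequences). [cite: Konieczny2020, Section 3] -/
theorem gap_mono {q r r' : ℕ} (hq : 2 ≤ q) (hrr' : r ≤ r') {f : ℕ → ℂ}
    (hf : IsSemimultiplicative q r f) (hf1 : ∀ n, ‖f n‖ = 1) : IsSemimultiplicative q r' f := by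
  induction hrr' with
  | refl => exact hf
  | step _ ih => exact gap_mono_succ hq ih hf1

/-- Dilation by `q^K` preserves `𝒮ℳ_r` (Konieczny 2020, Lemma 3.4 (1)).
[cite: Konieczny2020, Lemma 3.4] -/
theorem dilate {q r : ℕ} (hq : 2 ≤ q) {f : ℕ → ℂ} (hf : IsSemimultiplicative q r f) (K : ℕ) :
    IsSemimultiplicative q r (fun n => f (n * q ^ K)) := by
  have hqK : 0 < q ^ K := pow_pos (by omega) K
  refine ⟨by simpa using hf.1, fun l n m k hk hm hmr hn => ?_⟩
  have h := hf.2 (l + K) (n * q ^ K) (m * q ^ K) (k * q ^ K) ?_ ?_ ?_ ?_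
  · simpa [add_mul] using h
  · calc k * q ^ K < q ^ l * q ^ K := Nat.mul_lt_mul_of_pos_right hk hqK
      _ = q ^ (l + K) := by rw [pow_add]
  · rw [pow_add]; exact Nat.mul_dvd_mul hm dvd_rfl
  · calc m * q ^ K < q ^ (l + r) * q ^ K := Nat.mul_lt_mul_of_pos_right hmr hqK
      _ = q ^ (l + K + r) := by rw [← pow_add]; ring_nf
  · rw [show l + K + r = (l + r) + K by ring, pow_add]; exact Nat.mul_dvd_mul hn dvd_rfl

/-- `𝒮ℳ_r ⊆ 𝒬ℳ_r`: a `q`-semimultiplicative sequence is `q`-quasimultiplicative with the same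
gap (take `m = 0` in Definition 3.1). [cite: Konieczny2020, Section 3] -/
theorem isQuasimult {q r : ℕ} (hq : 2 ≤ q) {f : ℕ → ℂ} (hf : IsSemimultiplicative q r f) :
    IsQuasimult q r f := by
  intro l x y hy hx
  have h := hf.2 l x 0 y hy (dvd_zero _) (pow_pos (by omega) _) hx
  simpa [hf.1] using h

/-- Products of `𝒮ℳ_r` sequences are in `𝒮ℳ_r` (Lemma 3.4 (1)). [cite: Konieczny2020, Lemma 3.4] -/
theorem mul {q r : ℕ} {f g : ℕ → ℂ} (hf : IsSemimultiplicative q r f)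
    (hg : IsSemimultiplicative q r g) : IsSemimultiplicative q r (fun n => f n * g n) := by
  refine ⟨by simp [hf.1, hg.1], fun l n m k hk hm hmr hn => ?_⟩
  have h1 := hf.2 l n m k hk hm hmr hn
  have h2 := hg.2 l n m k hk hm hmr hn
  calc f (n + m + k) * g (n + m + k) * (f m * g m)
      = (f (n + m + k) * f m) * (g (n + m + k) * g m) := by ring
    _ = (f (n + m) * f (m + k)) * (g (n + m) * g (m + k)) := by rw [h1, h2]
    _ = f (n + m) * g (n + m) * (f (m + k) * g (m + k)) := by ring

/-- Conjugates of `𝒮ℳ_r` sequences are in `𝒮ℳ_r` (Lemma 3.4 (1)). [cite: Konieczny2020, Lemma 3.4] -/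
theorem conj' {q r : ℕ} {f : ℕ → ℂ} (hf : IsSemimultiplicative q r f) :
    IsSemimultiplicative q r (fun n => conj (f n)) := by
  refine ⟨by simp [hf.1], fun l n m k hk hm hmr hn => ?_⟩
  have h1 := hf.2 l n m k hk hm hmr hn
  rw [← map_mul, ← map_mul, h1]

/-! ## Digit blocks -/

/-- Low blocks are unaffected by high digits: `(hi q^s + lo) / q^a % q^b = lo / q^a % q^b` if
`a + b ≤ s` and `lo < q^s`. [folklore] -/
theorem block_low {q s a b hi lo : ℕ} (hq : 0 < q) (hab : a + b ≤ s) :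
    (hi * q ^ s + lo) / q ^ a % q ^ b = lo / q ^ a % q ^ b := by
  obtain ⟨c, rfl⟩ : ∃ c, s = a + b + c := ⟨s - (a + b), by omega⟩
  have h1 : hi * q ^ (a + b + c) + lo = q ^ a * (q ^ b * (hi * q ^ c)) + lo := by ring
  rw [h1, Nat.mul_add_div (pow_pos hq a), Nat.mul_add_mod]

/-- The top block: `(hi q^s + lo) / q^s = hi` for `lo < q^s`. [folklore] -/
theorem block_high {q s hi lo : ℕ} (hq : 0 < q) (hlo : lo < q ^ s) :
    (hi * q ^ s + lo) / q ^ s = hi := by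
  rw [mul_comm, Nat.mul_add_div (pow_pos hq s), Nat.div_eq_of_lt hlo, add_zero]

/-- Two adjacent blocks form one block of double length:
`m % q^r + q^r (m / q^r % q^r) = m % q^{2r}`. [folklore] -/
theorem mod_pow_two_mul (q r m : ℕ) : m % q ^ (2 * r) = m % q ^ r + q ^ r * (m / q ^ r % q ^ r) := by
  rw [two_mul, pow_add, Nat.mod_mul]

/-! ## The chain identity (Lemma 3.5 for consecutive blocks) -/

/-- **The chain identity** (Konieczny 2020, Lemmas 3.2 (2) / 3.5 for consecutive blocks of
length `r`, derived from Definition 3.1).  Let `f` be unimodular and `q`-semimultiplicative with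
gap `≤ r`, `B ≥ 1` and `m < q^{Br}`.  With the block values `x_b = m / q^{br} % q^r` (so that
`x_B = 0`) one has
`f(m) = f(x_0) · ∏_{b<B} f((m / q^{br} % q^{2r}) q^{br}) · conj ∏_{b<B} f(x_b q^{br})`
(note `(m / q^{br} % q^{2r}) q^{br} = x_b q^{br} + x_{b+1} q^{(b+1)r}`: the value of `f` on the
pair of blocks `b, b+1`). [cite: Konieczny2020, Lemma 3.5] -/
theorem chain_identity {q r : ℕ} (hq : 2 ≤ q) :
    ∀ (B : ℕ) {f : ℕ → ℂ}, IsSemimultiplicative q r f → (∀ n, ‖f n‖ = 1) →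
      ∀ m : ℕ, m < q ^ ((B + 1) * r) →
        f m = f (m % q ^ r) * (∏ b ∈ range (B + 1), f ((m / q ^ (b * r) % q ^ (2 * r)) * q ^ (b * r))) *
          conj (∏ b ∈ range (B + 1), f ((m / q ^ (b * r) % q ^ r) * q ^ (b * r))) := by
  have hqpos : 0 < q := by omega
  intro B
  induction B with
  | zero =>
      intro f hf hf1 m hm
      rw [zero_add, one_mul] at hm
      have hm2 : m < q ^ (2 * r) := lt_of_lt_of_le hm (Nat.pow_le_pow_right hqpos (by omega))
      simp only [zero_add, prod_range_one, zero_mul, pow_zero, Nat.div_one, mul_one,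
        Nat.mod_eq_of_lt hm, Nat.mod_eq_of_lt hm2]
      rw [mul_assoc, mul_conj_eq_one_of_norm (hf1 m), mul_one]
  | succ B ih =>
      intro f hf hf1 m hm
      -- the dilated sequence and the induction hypothesis
      set m₁ := m / q ^ r with hm₁
      have hm₁lt : m₁ < q ^ ((B + 1) * r) := by
        rw [hm₁, Nat.div_lt_iff_lt_mul (pow_pos hqpos r), ← pow_add]
        rwa [show (B + 1) * r + r = (B + 1 + 1) * r by ring]
      have hIH := ih (dilate hq hf r) (fun n => hf1 _) m₁ hm₁lt
      -- peel the bottom block: `f(m) f(m') = f(n' + m') f(m' + k)`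
      set k := m % q ^ r with hk
      set m' := (m / q ^ r % q ^ r) * q ^ r with hm'
      set n' := (m / q ^ r / q ^ r) * q ^ (r + r) with hn'
      have hdecomp : n' + m' + k = m := by
        rw [hn', hm', hk, pow_add]
        conv_rhs => rw [← Nat.mod_add_div m (q ^ r), ← Nat.mod_add_div (m / q ^ r) (q ^ r)]
        ring
      have hrel := hf.2 r n' m' k (Nat.mod_lt _ (pow_pos hqpos r)) (dvd_mul_left _ _)
        (by rw [hm', pow_add]
            exact Nat.mul_lt_mul_of_pos_right (Nat.mod_lt _ (pow_pos hqpos r)) (pow_pos hqpos r))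
        (dvd_mul_left _ _)
      rw [hdecomp] at hrel
      have hnm : n' + m' = m₁ * q ^ r := by
        rw [hn', hm', hm₁, pow_add]
        conv_rhs => rw [← Nat.mod_add_div (m / q ^ r) (q ^ r)]
        ring
      have hmk : m' + k = m % q ^ (2 * r) := by
        rw [hm', hk, mod_pow_two_mul]; ring
      rw [hnm, hmk] at hrel
      -- `f(m) = f(m₁ q^r) f(m % q^{2r}) conj f(m')`
      have hum' : f m' * conj (f m') = 1 := mul_conj_eq_one_of_norm (hf1 m')
      have hpeel : f m = f (m₁ * q ^ r) * f (m % q ^ (2 * r)) * conj (f m') := by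
        linear_combination conj (f m') * hrel - f m * hum'
      -- block bookkeeping: `m₁ / q^{br} = m / q^{(b+1)r}`
      have hdiv : ∀ b : ℕ, m₁ / q ^ (b * r) = m / q ^ ((b + 1) * r) := by
        intro b
        rw [hm₁, Nat.div_div_eq_div_mul, ← pow_add, show r + b * r = (b + 1) * r by ring]
      have hpow : ∀ b x : ℕ, x * q ^ (b * r) * q ^ r = x * q ^ ((b + 1) * r) := by
        intro b x
        rw [mul_assoc, ← pow_add, show b * r + r = (b + 1) * r by ring]
      simp only [hdiv, hpow] at hIH
      -- assemble
      rw [hpeel, hIH, prod_range_succ' (fun b => f ((m / q ^ (b * r) % q ^ (2 * r)) * q ^ (b * r))),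
        prod_range_succ' (fun b => f ((m / q ^ (b * r) % q ^ r) * q ^ (b * r)))]
      simp only [zero_mul, pow_zero, Nat.div_one, mul_one, map_mul]
      have hu0 : f k * conj (f k) = 1 := mul_conj_eq_one_of_norm (hf1 _)
      generalize (∏ x ∈ range (B + 1), f (m / q ^ ((x + 1) * r) % q ^ (2 * r) * q ^ ((x + 1) * r))) = P
      generalize (∏ x ∈ range (B + 1), f (m / q ^ ((x + 1) * r) % q ^ r * q ^ ((x + 1) * r))) = S
      linear_combination (P * conj S * f (m % q ^ (2 * r))) * hum' -
        (P * conj S * f (m % q ^ (2 * r))) * hu0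

/-! ## Independence of digit blocks -/

/-- **Independence of disjoint digit blocks.**  Let `[s_i, s_i + t_i)`, `i ≥ 0`, be digit
windows with `s_i + t_i ≤ s_{i+1}`.  Then for all `n` and all `L` with `s_i + t_i ≤ L` (`i < n`),
the average over `m < q^L` of `∏_{i<n} φ_i(m / q^{s_i} % q^{t_i})` equals the product of the
averages `q^{-t_i} ∑_{c<q^{t_i}} φ_i(c)`. [folklore] -/
theorem avg_prod_blocks {q : ℕ} (hq : 2 ≤ q) (s t : ℕ → ℕ) (hchain : ∀ i, s i + t i ≤ s (i + 1))
    (φ : ℕ → ℕ → ℂ) :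
    ∀ n L : ℕ, (∀ i < n, s i + t i ≤ L) →
      ((q : ℂ) ^ L)⁻¹ * ∑ m ∈ range (q ^ L), ∏ i ∈ range n, φ i (m / q ^ s i % q ^ t i) =
        ∏ i ∈ range n, (((q : ℂ) ^ t i)⁻¹ * ∑ c ∈ range (q ^ t i), φ i c) := by
  have hqpos : 0 < q := by omega
  have hqC : (q : ℂ) ≠ 0 := by exact_mod_cast hqpos.ne'
  have hsmono : Monotone s := monotone_nat_of_le_succ fun i => le_trans (Nat.le_add_right _ _) (hchain i)
  intro n
  induction n with
  | zero =>
      intro L _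
      simp only [prod_range_zero, sum_const, card_range, nsmul_eq_mul, mul_one]
      push_cast
      exact inv_mul_cancel₀ (pow_ne_zero L hqC)
  | succ n ih =>
      intro L hL
      set S := s n with hS
      set T := t n with hT
      obtain ⟨e, he⟩ : ∃ e, L = S + (T + e) := by
        have := hL n (Nat.lt_succ_self n); exact ⟨L - (S + T), by omega⟩
      have hlow : ∀ i < n, s i + t i ≤ S := by
        intro i hi
        exact (hchain i).trans (hsmono (Nat.succ_le_of_lt hi))
      have hIH := ih S hlow
      -- split `m = hi q^S + lo`
      rw [he, sum_range_pow_add]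
      have hterm : ∀ hi ∈ range (q ^ (T + e)), ∀ lo ∈ range (q ^ S),
          ∏ i ∈ range (n + 1), φ i ((hi * q ^ S + lo) / q ^ s i % q ^ t i) =
            (∏ i ∈ range n, φ i (lo / q ^ s i % q ^ t i)) * φ n (hi % q ^ T) := by
        intro hi _ lo hlo
        rw [mem_range] at hlo
        rw [prod_range_succ]
        congr 1
        · refine prod_congr rfl fun i hi' => ?_
          rw [mem_range] at hi'
          rw [block_low hqpos (hlow i hi')]
        · rw [← hS, ← hT, block_high hqpos hlo]
      rw [sum_congr rfl fun hi hhi => sum_congr rfl fun lo hlo => hterm hi hhi lo hlo]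
      simp_rw [← sum_mul]
      rw [← mul_sum]
      -- the sum over `hi`
      have hhi : ∑ hi ∈ range (q ^ (T + e)), φ n (hi % q ^ T) =
          (q : ℂ) ^ e * ∑ c ∈ range (q ^ T), φ n c := by
        rw [sum_range_pow_add]
        have : ∀ d ∈ range (q ^ e), ∑ c ∈ range (q ^ T), φ n ((d * q ^ T + c) % q ^ T) =
            ∑ c ∈ range (q ^ T), φ n c := by
          intro d _
          refine sum_congr rfl fun c hc => ?_
          rw [mem_range] at hc
          rw [Nat.mul_add_mod_of_lt hc]
        rw [sum_congr rfl this, sum_const, card_range, nsmul_eq_mul]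
        push_cast
        ring
      have hIH' : ∑ lo ∈ range (q ^ S), ∏ i ∈ range n, φ i (lo / q ^ s i % q ^ t i) =
          (q : ℂ) ^ S * ∏ i ∈ range n, (((q : ℂ) ^ t i)⁻¹ * ∑ c ∈ range (q ^ t i), φ i c) := by
        rw [← hIH, ← mul_assoc, mul_inv_cancel₀ (pow_ne_zero S hqC), one_mul]
      rw [hhi, hIH', prod_range_succ, ← hT]
      have hqS : (q : ℂ) ^ S ≠ 0 := pow_ne_zero S hqC
      have hqT : (q : ℂ) ^ T ≠ 0 := pow_ne_zero T hqC
      have hqe : (q : ℂ) ^ e ≠ 0 := pow_ne_zero e hqC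
      rw [pow_add, pow_add]
      field_simp

end Konieczny

end Literature.NumberTheory.LFunctions
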